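import Literature.NumberTheory.ComplexMultiplication.FaltingsTateOfInequivalentCMTypes
import Literature.NumberTheory.ComplexMultiplication.CMTypeIsogenousPrimitiveFamily
import Literature.AlgebraicGeometry.Milne1999.CMTypeSubquotients
import Literature.AlgebraicGeometry.Motives.FaltingsTatePotentiallyIsogenous
import HarnessLib

/-!
# (N9) [Faltings 1983, §5 Kor. 1] for every pair of abelian varieties over a number field that are of CM type over `ℂ`

Theorems only (topic `NumberTheory/ComplexMultiplication`; no definition, no named fact, no instance).
Cell `hodgecm-mathlib`, T5 distance ledger, item (N9) — ROAD OF RECORD (A-plan1 g8 01:13:03Z = B-p12's census §(c)):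
`P := A ⊞ A'` → (N9a) joint decomposition over ONE finite normal `E/k` into structures of PRIMITIVE CM types with
pairwise `Aut`-inequivalent types and multiplicities → ★ (N6c) `faltings_tate_bijective_of_isIsogenous_biproduct_of_inducedCMType_ne`
over `E` → ★ `faltings_tate_bijective_of_baseChange_end` ([Fal83] §5 ¶1 «wir dürfen `K` durch eine endliche
Erweiterung ersetzen») → ★ `faltings_tate_bijective_of_end_biprod` (Kor. 1 ⇐ Satz 4).

HEAD (`faltings_tate_bijective_of_isOfCMType_of_thm18_6`): for abelian varieties `A, A'` over a number field `k ⊆ ℂ`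
with `A ⊗ ℂ`, `A' ⊗ ℂ` of CM type (★ `Milne1999.IsOfCMType` — a commutative semisimple `ℚ`-subalgebra of `End⁰` of
degree `2·dim`; NO `k`-rationality of the complex multiplication is asked, so CM elliptic curves over `ℚ` and all
`k`-forms are included) and every prime `ℓ`, the Tate map `ℤ_ℓ ⊗ Hom_k(A, A') → Hom_{Γ_k}(T_ℓ A, T_ℓ A')` is bijective —
granted [Shimura1998, Thm. 18.6] (`h186`; ★ `shimura1998_thm18_6_holds` Summits-side).  This is the Tate conjecture
/ Faltings' isogeny theorem for the whole CM class, decided in the tree without [Fal83]'s heights.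

The joint decomposition (N9a) is ★ `exists_isIsogenous_biproduct_primitive_family_of_isOfCMType`
(`CMTypeIsogenousPrimitiveFamily`, B-p12): Poincaré reducibility over `ℂ` into simple CM factors ([Shimura1998] §5.1
Prop. 3), primitivity of simple realisations (§8.2 Prop. 26), pairwise inequivalence of the types of non-isogenous
simple factors ([MilneCM2006] I Prop. 3.13), models over a number field (§12.4 Prop. 26) and descent of the isogeny
to a finite normal extension ([Fal83] §5 ¶1).

## References

* [Faltings1983Endlichkeit] G. Faltings, Invent. Math. 73 (1983), §5 ¶1, Satz 4 and Korollar 1.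
* [Shimura1998] G. Shimura, *Abelian Varieties with Complex Multiplication and Modular Functions* (1998),
  §5.1 Prop. 3, §6.2 Thm. 3, §8.2 Prop. 26, §13.1–13.2, §18.6 Thm. 18.6.
* [Milne1999] J. S. Milne, *Lefschetz motives and the Tate conjecture*, Compositio Math. 117 (1999), §2 p. 54.
-/

noncomputable section

open scoped NumberField
open NumberField CategoryTheory CategoryTheory.Limits
open Literature.AlgebraicGeometry.Motives Literature.AlgebraicGeometry.Motives.AbelianVariety
open Literature.AlgebraicGeometry.Milne1999 (IsOfCMType)

namespace Literature.NumberTheory.ComplexMultiplication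

/-! ## The head -/

/-- `A ⊞ A'` is of CM type over `ℂ` when `A` and `A'` are (★ `Milne1999.isOfCMType_biprod_iff` through ★
`nonempty_baseChange_biprod_iso`: base change commutes with `⊞`). [cite: Milne1999, §2 p. 54] -/
theorem isOfCMType_baseChange_biprod {k : Type} [Field k] [Algebra k ℂ] {A A' : AbelianVariety k}
    (hA : IsOfCMType (A.baseChange ℂ)) (hA' : IsOfCMType (A'.baseChange ℂ)) :
    IsOfCMType ((A ⊞ A').baseChange ℂ) := by
  obtain ⟨e⟩ := nonempty_baseChange_biprod_iso ℂ A A'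
  exact (Literature.AlgebraicGeometry.Milne1999.isOfCMType_iff_of_isIsogenous ⟨e.hom, isIsogeny_hom_of_iso e⟩).2
    (Literature.AlgebraicGeometry.Milne1999.isOfCMType_biprod_iff.2 ⟨hA, hA'⟩)

/-- **(N9) — [Fal83 §5 Kor. 1] for EVERY pair of abelian varieties over a number field that are of CM type over `ℂ`**,
granted [Shimura1998, Thm. 18.6] (`h186`): the Tate map
`ℤ_ℓ ⊗ Hom_k(A, A') → Hom_{Γ_k}(T_ℓ A, T_ℓ A')` is bijective.  `P := A ⊞ A'` is of CM type over `ℂ`; (N9a) decomposes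
`P ⊗ E` over one finite normal `E/k` into primitive structures with pairwise inequivalent types; ★ (N6c) gives the `End`
statement for `P ⊗ E`; it descends to `P` over `k` (★ `faltings_tate_bijective_of_baseChange_end`) and splits
(★ `faltings_tate_bijective_of_end_biprod`). [cite: Faltings1983Endlichkeit, §5 ¶1, Satz 4 and Korollar 1]
[cite: Shimura1998, §13.2 Thm. 2 and §18.6 Thm. 18.6] [cite: Milne1999, §2 p. 54] -/
theorem faltings_tate_bijective_of_isOfCMType_of_thm18_6 (h186 : shimura1998_thm18_6)
    {k : Type} [Field k] [NumberField k] [Algebra k ℂ] (A A' : AbelianVariety k)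
    (hA : IsOfCMType (A.baseChange ℂ)) (hA' : IsOfCMType (A'.baseChange ℂ)) (ℓ : ℕ) [Fact ℓ.Prime] :
    faltings_tate_bijective A A' ℓ := by
  classical
  obtain ⟨E, hfd, hnorm, C, hC, K, hF, hNF, hCM, Φ, B, ιB, φ₀, hB, hprim, hK, m, cls, hiso, -⟩ :=
    exists_isIsogenous_biproduct_primitive_family_of_isOfCMType (A ⊞ A') (isOfCMType_baseChange_biprod hA hA')
  haveI : FiniteDimensional k E := hfd
  haveI : Normal k E := hnorm
  haveI : NumberField E := NumberField.of_module_finite k E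
  -- `End` of `(A ⊞ A') ⊗ E` by (N6c)
  have hE : faltings_tate_bijective ((A ⊞ A').baseChange E) ((A ⊞ A').baseChange E) ℓ :=
    faltings_tate_bijective_of_isIsogenous_biproduct_of_inducedCMType_ne h186 Φ B ιB hB hprim hK ℓ cls cls hiso hiso
  -- descend to `k` and take the corner
  have hk : faltings_tate_bijective A A' ℓ :=
    faltings_tate_bijective_of_end_biprod A A' ℓ (faltings_tate_bijective_of_baseChange_end E ℓ (A ⊞ A') hE)
  intro _
  exact hk

/-- **The `End` form** ([Fal83 §5 Satz 4] for the CM class): `ℤ_ℓ ⊗ End_k(A) → End_{Γ_k}(T_ℓ A)` is bijective for every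
abelian variety over a number field that is of CM type over `ℂ`, granted [Shimura1998, Thm. 18.6].
[cite: Faltings1983Endlichkeit, §5 Satz 4] [cite: Shimura1998, §18.6 Thm. 18.6] -/
theorem faltings_tate_bijective_self_of_isOfCMType_of_thm18_6 (h186 : shimura1998_thm18_6)
    {k : Type} [Field k] [NumberField k] [Algebra k ℂ] (A : AbelianVariety k) (hA : IsOfCMType (A.baseChange ℂ))
    (ℓ : ℕ) [Fact ℓ.Prime] : faltings_tate_bijective A A ℓ := by
  have hk := faltings_tate_bijective_of_isOfCMType_of_thm18_6 h186 A A hA hA ℓ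
  intro _
  exact hk

/-- **… and on the `k`-isogeny classes**: `faltings_tate_bijective B B' ℓ` for every `B ∼ A`, `B' ∼ A'` with `A ⊗ ℂ`,
`A' ⊗ ℂ` of CM type (★ `faltings_tate_bijective_of_isIsogenous`; of course `B ⊗ ℂ`, `B' ⊗ ℂ` are then of CM type too,
★ `isOfCMType_iff_of_isIsogenous`). [cite: Faltings1983Endlichkeit, §5 Korollar 1 and §5 ¶1] -/
theorem faltings_tate_bijective_of_isIsogenous_of_isOfCMType_of_thm18_6 (h186 : shimura1998_thm18_6)
    {k : Type} [Field k] [NumberField k] [Algebra k ℂ] {A A' B B' : AbelianVariety k}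
    (hA : IsOfCMType (A.baseChange ℂ)) (hA' : IsOfCMType (A'.baseChange ℂ))
    (hB : IsIsogenous A B) (hB' : IsIsogenous A' B') (ℓ : ℕ) [Fact ℓ.Prime] :
    faltings_tate_bijective B B' ℓ := by
  have hk := faltings_tate_bijective_of_isIsogenous ℓ hB hB'
    (faltings_tate_bijective_of_isOfCMType_of_thm18_6 h186 A A' hA hA' ℓ)
  intro _
  exact hk

end Literature.NumberTheory.ComplexMultiplication

end
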